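/-
Copyright: H21 programme, solo seat `solo-RiemannHypothesis-informed` (session 5).
-/
import Summits.RiemannHypothesis.RiemannHypothesis.Theorems.SoloInformedNearCluster

/-!
# The near-count wall: the cluster radius eliminated (solo-informed, T36)

In T35 the near-cluster hypothesis carries a radius `R₀` (members within `R₀` of `½ + iγ₀`).
Since a member that matters is an off-line zero of the near zone `|Im ρ − γ₀| < Δ₀`, its
distance from `½ + iγ₀` is `< Δ₀ + ½` automatically; taking `R₀ = Δ₀ + 1` costs a factor
`Δ₀^{4N}` in `K_{N,p}` (`clusterKp_radius_le`), i.e. `(2N/η) log Δ₀ = κ a` in the window with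
`κ = N/(η(p+1))`, which is absorbed as soon as `κ < 1` (`p + 1 > N/η`).  Result:

**T36** (`weilGroundEnergy_neg_of_nearCount_closed_eff`): for `0 < η < ½`, `Φ(η) > 0`,
`N < η(p+1)`, `0 < δ ≤ 1`, with the window
`a(γ₀) = nearCountWindow ψ N p δ η γ₀ = (c₀,p(2) + κ + log log(|γ₀|+2)/(2η))/(1 − κ) + 1`:
if `|γ₀| ≥ 1`, `ζ(½ + η + iγ₀) = 0`, and the off-line zeros with `|Im ρ − γ₀| < e^{a/(2p+2)}`
other than `½ ± η + iγ₀` are among `≤ N` points each at distance `≥ δ` from `½ ± η + iγ₀`, then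
`weilGroundEnergy a < 0`.  The only data left are a COUNT (`N`) and a SEPARATION from the pair
(`δ`); **T36″** is the exclusion form.
-/

open MeasureTheory Complex Set Filter Topology Literature.NumberTheory.LFunctions
open scoped ContDiff

namespace Summit.RiemannHypothesis.RiemannHypothesis.Theorems

variable {ψ : ℝ → ℝ}

/-- Radius growth of `K_{N,p}`: `K_{N,p}(Δ₀ + 1) ≤ K_{N,p}(2) · Δ₀^{4N}` for `Δ₀ ≥ 1`. -/
theorem clusterKp_radius_le (ψ : ℝ → ℝ) (N p : ℕ) {Δ₀ : ℝ} (hΔ : 1 ≤ Δ₀) :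
    clusterKp ψ N (Δ₀ + 1) p ≤ clusterKp ψ N 2 p * Δ₀ ^ (4 * N) := by
  unfold clusterKp
  set A := zetaDensityConst with hA_def
  set B := bumpNormSum ψ (2 * N + 4 + p) with hB_def
  have hA : 0 < A := zetaDensityConst_pos
  have hB : 0 ≤ B := bumpNormSum_nonneg ψ _
  have h5 : 1 + (Δ₀ + 1) ^ 2 ≤ 5 * Δ₀ ^ 2 := by nlinarith
  have h1 : (1 + (Δ₀ + 1) ^ 2) ^ N ≤ (5 * Δ₀ ^ 2) ^ N :=
    pow_le_pow_left₀ (by positivity) h5 N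
  have h2 : ((1 + (Δ₀ + 1) ^ 2) ^ N * B) ^ 2 ≤ ((5 * Δ₀ ^ 2) ^ N * B) ^ 2 :=
    pow_le_pow_left₀ (by positivity) (mul_le_mul_of_nonneg_right h1 hB) 2
  have e : ((5 * Δ₀ ^ 2) ^ N * B) ^ 2 = ((1 + 2 ^ 2) ^ N * B) ^ 2 * Δ₀ ^ (4 * N) := by
    norm_num; ring
  have hW : 1 ≤ Δ₀ ^ (4 * N) := one_le_pow₀ hΔ
  have h3 : 16 * A * ((1 + (Δ₀ + 1) ^ 2) ^ N * B) ^ 2 ≤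
      16 * A * (((1 + 2 ^ 2) ^ N * B) ^ 2 * Δ₀ ^ (4 * N)) :=
    mul_le_mul_of_nonneg_left (h2.trans e.le) (by positivity)
  calc 16 * A * ((1 + (Δ₀ + 1) ^ 2) ^ N * B) ^ 2 + 1
      ≤ 16 * A * (((1 + 2 ^ 2) ^ N * B) ^ 2 * Δ₀ ^ (4 * N)) + Δ₀ ^ (4 * N) := by linarith
    _ = (16 * A * ((1 + 2 ^ 2) ^ N * B) ^ 2 + 1) * Δ₀ ^ (4 * N) := by ring

/-- Radius growth of the window constant:
`c₀,p(Δ₀ + 1) ≤ c₀,p(2) + (2N/η) log Δ₀` for `Δ₀ ≥ 1`. -/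
theorem clusterFarC0p_radius_le (ψ : ℝ → ℝ) (N p : ℕ) {δ η Δ₀ : ℝ} (hδ : 0 < δ) (hη : 0 < η)
    (hΦ : 0 < bumpLaplace ψ η) (hΔ : 1 ≤ Δ₀) :
    clusterFarC0p ψ N (Δ₀ + 1) p δ η ≤
      clusterFarC0p ψ N 2 p δ η + 2 * N / η * Real.log Δ₀ := by
  have hlog0 : 0 ≤ Real.log Δ₀ := Real.log_nonneg hΔ
  have hE : 0 ≤ 2 * N / η * Real.log Δ₀ := by positivity
  have hK₂ : 0 < clusterKp ψ N 2 p := clusterKp_pos ψ N 2 p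
  have hW : 1 ≤ Δ₀ ^ (4 * N) := one_le_pow₀ hΔ
  have hKK : clusterKp ψ N (Δ₀ + 1) p ≤ clusterKp ψ N 2 p * Δ₀ ^ (4 * N) :=
    clusterKp_radius_le ψ N p hΔ
  set D : ℝ := η ^ 4 * bumpLaplace ψ η ^ 2 with hD_def
  have hD : 0 < D := by positivity
  set X₂ : ℝ := 4 * (2 * clusterKp ψ N 2 p / δ ^ (4 * N)) / D with hX₂_def
  have hX₂ : 0 ≤ X₂ := by positivity
  have hX : 4 * (2 * clusterKp ψ N (Δ₀ + 1) p / δ ^ (4 * N)) / D ≤ X₂ * Δ₀ ^ (4 * N) := by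
    have ex : X₂ * Δ₀ ^ (4 * N) =
        4 * (2 * (clusterKp ψ N 2 p * Δ₀ ^ (4 * N)) / δ ^ (4 * N)) / D := by
      rw [hX₂_def]; ring
    rw [ex]
    gcongr
  have hΔpos : 0 < Δ₀ := by linarith
  have hK' : 0 < clusterKp ψ N (Δ₀ + 1) p := clusterKp_pos ψ N _ p
  have hlog : Real.log (4 * (2 * clusterKp ψ N (Δ₀ + 1) p / δ ^ (4 * N)) / D + 1) ≤
      Real.log (X₂ + 1) + 4 * N * Real.log Δ₀ := by
    have epow : 4 * (N : ℝ) * Real.log Δ₀ = Real.log (Δ₀ ^ (4 * N)) := by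
      rw [Real.log_pow]; push_cast; ring
    have hne1 : X₂ + 1 ≠ 0 := by positivity
    have hne2 : Δ₀ ^ (4 * N) ≠ 0 := by positivity
    rw [epow, ← Real.log_mul hne1 hne2]
    apply Real.log_le_log (by positivity)
    have : (X₂ + 1) * Δ₀ ^ (4 * N) = X₂ * Δ₀ ^ (4 * N) + Δ₀ ^ (4 * N) := by ring
    linarith
  unfold clusterFarC0p
  refine max_le ((le_max_left _ _).trans (le_add_of_nonneg_right hE)) ?_
  calc Real.log (4 * (2 * clusterKp ψ N (Δ₀ + 1) p / δ ^ (4 * N)) /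
          (η ^ 4 * bumpLaplace ψ η ^ 2) + 1) / (2 * η)
      ≤ (Real.log (X₂ + 1) + 4 * N * Real.log Δ₀) / (2 * η) :=
        div_le_div_of_nonneg_right hlog (by positivity)
    _ = Real.log (X₂ + 1) / (2 * η) + 2 * N / η * Real.log Δ₀ := by field_simp; ring
    _ ≤ _ := by rw [hX₂_def]; gcongr; exact le_max_right _ _

/-- The window of the near-count wall:
`a(γ₀) = (c₀,p(2) + κ + log log(|γ₀|+2)/(2η))/(1 − κ) + 1`, `κ = N/(η(p+1))`. -/
noncomputable def nearCountWindow (ψ : ℝ → ℝ) (N p : ℕ) (δ η γ₀ : ℝ) : ℝ :=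
  (clusterFarC0p ψ N 2 p δ η + N / (η * (p + 1)) +
      Real.log (Real.log (|γ₀| + 2)) / (2 * η)) / (1 - N / (η * (p + 1))) + 1

/-- **T36 (the near-count wall).**  See the module docstring: the near hypothesis is a count
`≤ N` of the other off-line zeros in the zone `|Im ρ − γ₀| < e^{a/(2p+2)}` and their separation
`≥ δ` from `½ ± η + iγ₀`; no radius, nothing outside the zone. -/
theorem weilGroundEnergy_neg_of_nearCount_closed_eff (hψ : ContDiff ℝ ∞ ψ)
    (hsupp : tsupport ψ ⊆ Icc (-1) 1) (hψ0 : ∀ s, 0 ≤ ψ s) {η : ℝ} (hη : 0 < η)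
    (hη2 : η < 1 / 2) (hΦ : 0 < bumpLaplace ψ η) (N p : ℕ) (hκ : (N : ℝ) < η * (p + 1))
    {δ : ℝ} (hδ : 0 < δ) (hδ1 : δ ≤ 1) :
    ∀ (γ₀ : ℝ) (S' : Finset ℂ), 1 ≤ |γ₀| → riemannZeta (1 / 2 + η + γ₀ * I) = 0 → S'.card ≤ N →
      (∀ ρ ∈ S', δ ≤ ‖ρ - (1 / 2 + η + γ₀ * I)‖ ∧ δ ≤ ‖ρ - (1 / 2 - η + γ₀ * I)‖) →
      (∀ ρ : ℂ, riemannZeta ρ = 0 → 0 ≤ ρ.re → ρ.re ≤ 1 →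
          |ρ.im - γ₀| < Real.exp (nearCountWindow ψ N p δ η γ₀ / (2 * p + 2)) →
          ρ.re ≠ 1 / 2 → ρ = 1 / 2 + η + γ₀ * I ∨ ρ = 1 / 2 - η + γ₀ * I ∨ ρ ∈ S') →
      weilGroundEnergy (nearCountWindow ψ N p δ η γ₀) < 0 := by
  intro γ₀ S' hγ hζ hcard hsep hnear
  set κ : ℝ := N / (η * (p + 1)) with hκ_def
  have hκ0 : 0 ≤ κ := by positivity
  have hκ1 : κ < 1 := by rw [hκ_def, div_lt_one (by positivity)]; exact hκ
  have h1κ : 0 < 1 - κ := by linarith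
  set LL : ℝ := Real.log (Real.log (|γ₀| + 2)) / (2 * η) with hLL_def
  set c₂ : ℝ := clusterFarC0p ψ N 2 p δ η with hc₂_def
  set c : ℝ := (c₂ + κ + LL) / (1 - κ) with hc_def
  have ea : nearCountWindow ψ N p δ η γ₀ = c + 1 := rfl
  rw [ea] at hnear ⊢
  have hL : 1 < Real.log (|γ₀| + 2) := by
    rw [Real.lt_log_iff_exp_lt (by positivity)]
    linarith [Real.exp_one_lt_d9, abs_nonneg γ₀]
  have hLL : 0 ≤ LL := by have := (Real.log_pos hL).le; positivity
  have hc₂ : 0 ≤ c₂ := clusterFarC0p_nonneg hψ0 hη hΦ N 2 p δ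
  have hc0 : 0 ≤ c := div_nonneg (by linarith) h1κ.le
  have hc1 : 0 ≤ c + 1 := by linarith
  have hmul : (1 - κ) * c = c₂ + κ + LL := by rw [hc_def]; field_simp
  -- internal parameters
  set R : ℝ := Real.exp ((c + 1) / 2) with hR_def
  set Δ₀ : ℝ := Real.exp ((c + 1) / (2 * p + 2)) with hΔ_def
  have hR : 1 ≤ R := Real.one_le_exp (by positivity)
  have hR1 : Real.exp (c + 1) ≤ R ^ 2 := by
    rw [hR_def, ← Real.exp_nat_mul]; push_cast
    exact Real.exp_le_exp.mpr (by linarith)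
  have hΔ1 : 1 ≤ Δ₀ := Real.one_le_exp (by positivity)
  obtain ⟨hθ0, hθ2, hoff⟩ := windowMaxOffset_spec γ₀ R
  have hΔ : Real.exp (windowMaxOffset γ₀ R * (c + 1)) ≤ Δ₀ ^ (p + 1) := by
    rw [hΔ_def, ← Real.exp_nat_mul]
    refine Real.exp_le_exp.mpr ?_
    have hp : ((p + 1 : ℕ) : ℝ) * ((c + 1) / (2 * p + 2)) = (c + 1) / 2 := by
      push_cast; field_simp
    rw [hp]
    nlinarith
  -- the window inequality with radius `Δ₀ + 1`
  have hkey : clusterFarC0p ψ N (Δ₀ + 1) p δ η + LL ≤ c := by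
    have h1 := clusterFarC0p_radius_le ψ N p hδ hη hΦ hΔ1
    have hlogΔ : Real.log Δ₀ = (c + 1) / (2 * p + 2) := by rw [hΔ_def, Real.log_exp]
    have h2 : 2 * (N : ℝ) / η * Real.log Δ₀ = κ * c + κ := by
      rw [hlogΔ, hκ_def]; field_simp
    have h3 : (1 - κ) * c = c - κ * c := by ring
    rw [h2] at h1
    linarith
  -- the filtered cluster
  set S'' : Finset ℂ := S'.filter (fun ρ ↦ ‖ρ - (1 / 2 + γ₀ * I)‖ ≤ Δ₀ + 1) with hS_def
  have hcard'' : S''.card ≤ N := (Finset.card_filter_le _ _).trans hcard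
  have hclus'' : ∀ ρ ∈ S'', ‖ρ - (1 / 2 + γ₀ * I)‖ ≤ Δ₀ + 1 ∧ δ ≤ ‖ρ - (1 / 2 + η + γ₀ * I)‖ ∧
      δ ≤ ‖ρ - (1 / 2 - η + γ₀ * I)‖ := by
    intro ρ hρ
    rw [hS_def, Finset.mem_filter] at hρ
    exact ⟨hρ.2, (hsep ρ hρ.1).1, (hsep ρ hρ.1).2⟩
  have hloc : ∀ ρ : ℂ, riemannZeta ρ = 0 → 0 ≤ ρ.re → ρ.re ≤ 1 → |ρ.im - γ₀| < R →
      ρ.re ≠ 1 / 2 → ρ = 1 / 2 + η + γ₀ * I ∨ ρ = 1 / 2 - η + γ₀ * I ∨ ρ ∈ S'' ∨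
        (|ρ.re - 1 / 2| ≤ windowMaxOffset γ₀ R ∧ Δ₀ ≤ |ρ.im - γ₀|) := by
    intro ρ hz h0 h1 hRρ hre
    by_cases hn : |ρ.im - γ₀| < Δ₀
    · rcases hnear ρ hz h0 h1 hn hre with h | h | h
      · exact Or.inl h
      · exact Or.inr (Or.inl h)
      · refine Or.inr (Or.inr (Or.inl ?_))
        rw [hS_def, Finset.mem_filter]
        refine ⟨h, ?_⟩
        have hri : |ρ.re - 1 / 2| ≤ 1 / 2 := abs_le.mpr ⟨by linarith, by linarith⟩
        have hre' : (ρ - (1 / 2 + γ₀ * I)).re = ρ.re - 1 / 2 := by simp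
        have him' : (ρ - (1 / 2 + γ₀ * I)).im = ρ.im - γ₀ := by simp
        calc ‖ρ - (1 / 2 + γ₀ * I)‖
            ≤ |(ρ - (1 / 2 + γ₀ * I)).re| + |(ρ - (1 / 2 + γ₀ * I)).im| :=
              Complex.norm_le_abs_re_add_abs_im _
          _ ≤ Δ₀ + 1 := by rw [hre', him']; linarith [hn.le]
    · exact Or.inr (Or.inr (Or.inr ⟨hoff ρ hz h0 h1 hRρ, not_lt.mp hn⟩))
  exact weilGroundEnergy_neg_of_farOffset_cluster_decay_window_eff hψ hsupp hψ0 hη hη2 hΦ N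
    (Δ₀ + 1) p hδ hδ1 hθ2 γ₀ c R Δ₀ S'' hγ hkey hR hR1 hΔ hΔ1 hζ hcard'' hclus'' hloc

/-- **T36″ (the near-count wall, exclusion form).** -/
theorem riemannZeta_ne_zero_of_nearCount_closed_eff (hψ : ContDiff ℝ ∞ ψ)
    (hsupp : tsupport ψ ⊆ Icc (-1) 1) (hψ0 : ∀ s, 0 ≤ ψ s) {η : ℝ} (hη : 0 < η)
    (hη2 : η < 1 / 2) (hΦ : 0 < bumpLaplace ψ η) (N p : ℕ) (hκ : (N : ℝ) < η * (p + 1))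
    {δ : ℝ} (hδ : 0 < δ) (hδ1 : δ ≤ 1) :
    ∀ (γ₀ : ℝ) (S' : Finset ℂ), 1 ≤ |γ₀| → S'.card ≤ N →
      (∀ ρ ∈ S', δ ≤ ‖ρ - (1 / 2 + η + γ₀ * I)‖ ∧ δ ≤ ‖ρ - (1 / 2 - η + γ₀ * I)‖) →
      (∀ ρ : ℂ, riemannZeta ρ = 0 → 0 ≤ ρ.re → ρ.re ≤ 1 →
          |ρ.im - γ₀| < Real.exp (nearCountWindow ψ N p δ η γ₀ / (2 * p + 2)) →
          ρ.re ≠ 1 / 2 → ρ = 1 / 2 + η + γ₀ * I ∨ ρ = 1 / 2 - η + γ₀ * I ∨ ρ ∈ S') →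
      0 ≤ weilGroundEnergy (nearCountWindow ψ N p δ η γ₀) →
      riemannZeta (1 / 2 + η + γ₀ * I) ≠ 0 := by
  intro γ₀ S' hγ hcard hsep hnear hE hζ
  have := weilGroundEnergy_neg_of_nearCount_closed_eff hψ hsupp hψ0 hη hη2 hΦ N p hκ hδ hδ1 γ₀
    S' hγ hζ hcard hsep hnear
  linarith

end Summit.RiemannHypothesis.RiemannHypothesis.Theorems
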